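import Summits.QuantumFields.YangMills.Theorems.BalabanUVNodesN15CurvedGluingCubeDressedGeneralRemainderRowDefect
import HarnessLib

/-!
# Route «BalabanUVNodes» (cluster K4 «SpineRates»), Track-A DAG node N15 = NE2, BACKGROUND LAYER — THE η-DEFECT OF THE DRESSED CUBE's REMAINDER ROW, ASSEMBLED: FILE 58's `hDK` for the
# general dressed cube with its own operator `Σ∇*∇ + W + N − 𝒱`, every letter from the flat cubes' data at both grids, the perturbation's decay∕defect, the partition's letters and fits

Cell `pub-ymgap`, seat `pub-ymgap-dag-n15-w4` (WIDTH SEAT 4 on node N15; third piece of dag-n15-w3 g3's located (h) «+ its `hKc`∕`hDK` assembly», split from `…RemainderRowDefect` for the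
400-line budget).  `bears_on: R4∕N15 · K3⁷ SpineGivenEndpointR13SepCoPH (stmt-QuantumFields-20544)`.  Filed `--kind proof --supports stmt-QuantumFields-20544 --as helper` — COUNT-NEUTRAL.
One theorem; 0 `sorry`.  Imports BY NAME this seat's `…RemainderRowDefect` (`hasMaj_idef_jetRem_diagK`, `abs_jetReading_fit_le`, `hasMaj_idef_commOp_lapOp_dressedV_loc₂`, `hasMaj_idef_commOp_comp_in`;
through it `…RemainderRow`, dag-n15-w3 files 23–28, dag-n15-c FILES 46∕56∕57); nothing in the tree is modified, nothing re-declared.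

WHY.  dag-n15-c FILE 58 `gluedLetters_of_cubeRows_in` consumes per cube the pair (`hKc`, `hDK`); `…RemainderRow` §3 gave `hKc` for the general dressed cube, THIS FILE gives `hDK`:
`𝔇([Σ∇′*∇′ + W′ + N′ − 𝒱′, M_{h′}]∘X′, [Σ∇*∇ + W + N − 𝒱, M_h]∘X)` = (flat local half: `…RemainderRowDefect` §2) + (nonlocal summand: §3 there) − (dressed perturbation: dag-n15-w3 file 28
`hasMaj_idef_commOp_dressedPert_comp`, whose letter-level inputs are discharged here for the CONCRETE forward∕backward jets — the twisted commutator `V̂′M_{a′} − M_{h′}V̂′` by FILE 56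
`hasMaj_comm_nonlocal` at the fine grid, its defect by file 28 `hasMaj_idef_twistedComm` with the jet readings' letters `abs_jetReading_sub_le`∕`abs_jetReading_fit_le`, the pair and its defect by
files 23∕24 `hasMaj_dressedV_pair`∕`hasMaj_idef_dressedV_pair`, the jets' Leibniz remainders by `hasMaj_jetRem_diagK`∕`hasMaj_idef_jetRem_diagK`), all brought to one kernel at rate `ρ₃` and
input-localized (`X = XM_ψ`, `X′ = X′M_{ψ′}` — file 26 `hasMaj_localize_in`).
* ★★★ `hasMaj_idef_commOp_cubeOp_dressedV_in` — `≤ 1_S(y′)·r₀·e^{−ρ₃d}` with `r₀` displayed in closed form (see the theorem's docstring).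

HONEST FRAMING ∕ LIMITS.  Finite-dimensional operator algebra + block-majorant bookkeeping over DISPLAYED letters (flat cube data at two grids, `R, δ_V, o`, the partition's `c₁ c₂ o₁ o₂ ℓ ω d₁ oo`,
the flat `W`∕`N` letters `r_W, c_N, r_N`); [B6] (2.91)–(2.92) p. 239, (2.133)–(2.134) p. 247, [B5] (1.120)–(1.128) pp. 37–38, [B9] (3.62)–(3.65), (3.76)–(3.77), Thm 3.14 pp. 426–427 = SHAPES ∕
MECHANISM — nothing of [B5]∕[B6]∕[B9] asserted.  NE2⁺ NOT PRINTED, NOT proved; N15 NOT discharged; counts of record UNMOVED (typed 28∕28 · discharged 5∕27); no summit statement is proved here;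
one finite 𝕋⁴ at fixed ε — NOT infinite volume, NOT OS on ℝ⁴, NOT a mass gap, NOT Clay; R4 closes the conditional finite-𝕋⁴ rung `BalabanLadder.UV` only.  Restate-immune (no Theses import).
-/

set_option autoImplicit false

noncomputable section
open scoped BigOperators
open Finset

namespace Summit.QuantumFields.YangMills.BalabanUVNodes.N15.CurvedSpecies

open Literature.MathematicalPhysics.QuantumFieldTheory.Balaban1983to89
open Literature.MathematicalPhysics.QuantumFieldTheory.Balaban1983to89.B11SectG (BlockNorm HasMaj RowSum hasMaj_zero hasMaj_comp_exp)
open Literature.MathematicalPhysics.QuantumFieldTheory.Balaban1983to89.B6RandomWalk (Triangle254)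
open Literature.MathematicalPhysics.QuantumFieldTheory.Balaban1983to89.T4EtaRateDefect (idef idef_apply idef_comp idef_add idef_sub)
open Literature.MathematicalPhysics.QuantumFieldTheory.Balaban1983to89.T4EtaRateCoeffDefect (pull pull_apply diagK diagK_nonneg hasMaj_mulOp hasMaj_idef_mulOp)
open Literature.MathematicalPhysics.QuantumFieldTheory.Balaban1983to89.B6Prop26Gluing (mulOp mulOp_apply ind ind_nonneg ind_le_one ind_of_mem)
open Summit.QuantumFields.YangMills.BalabanUVNodes.N15.MatrixSpecies (liftBlk liftMap liftEquiv liftEquiv_apply liftEquiv_symm_apply)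
open Summit.QuantumFields.YangMills.BalabanUVNodes.N15.BackgroundModel (kappa_ofBlocks)
open Summit.QuantumFields.YangMills.BalabanUVNodes.N15.BackgroundLayer (fgrad bgrad fgradAdj fgrad_apply bgrad_apply stack projO blkPair liftPair hasMaj_stack hasMaj_projO_comp idef_stack
  bgPropV projO_none_comp_stack projO_some_comp_stack)
open Summit.QuantumFields.YangMills.BalabanUVNodes.N15.Gluing (commOp lapOp commOp_add_left hasMaj_idef_commOp_lapOp_comp hasMaj_comm_nonlocal hasMaj_comp_exp_in)

/-! ## FILE 58's `hDK` for the dressed cube: the η-defect of `[Σ∇*∇ + W + N − 𝒱, M_h]∘X`, input-localized -/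

section Row

variable {X X' ι J : Type} [Fintype X] [Fintype X'] [DecidableEq X] [DecidableEq X'] [Fintype ι] [DecidableEq ι] [Fintype J] [DecidableEq J] {g : B6.Geometry}
  (blk : X → g.Site) (π : X' → X) (τ : J → X ≃ X) (τ' : J → X' ≃ X') (n n' : ℝ) {σ cr : ℝ}
  {G₀ : (X × ι → ℝ) →ₗ[ℝ] (X × ι → ℝ)} {D Dq : J ⊕ J → (X × ι → ℝ) →ₗ[ℝ] (X × ι → ℝ)} {V : ((X × ι) × Option (J ⊕ J) → ℝ) →ₗ[ℝ] (X × ι → ℝ)}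
  {G₀' : (X' × ι → ℝ) →ₗ[ℝ] (X' × ι → ℝ)} {D' Dq' : J ⊕ J → (X' × ι → ℝ) →ₗ[ℝ] (X' × ι → ℝ)} {V' : ((X' × ι) × Option (J ⊕ J) → ℝ) →ₗ[ℝ] (X' × ι → ℝ)}

/-- ★★★ **THE η-DEFECT OF THE DRESSED CUBE's REMAINDER ROW, FILE 58's `hDK` SHAPE**: with the data of `hasMaj_idef_commOp_lapOp_dressedV_loc₂` (flat cubes at both grids, cut-offs, jets, the
perturbations and their defect `o`, fine partition letters `c₁ c₂`, fits `o₁ o₂`, `W`-defect row `r_W`), the COARSE partition's `|∇^±h| ≤ c₁`, both partitions within `ω` of one `ℓ`-block-Lipschitz block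
constant `hb`, the fit `|h′ − h∘π̂| ≤ oo`, one lattice step (coarse or fine) moving a block by `≤ d₁`, spacings `n, n′ > 0`, symmetric distance, `ε > 0`, rates `ρ₃ ≤ ρ₂`, `ρ₃ + σ ≤ δ_V − ε`,
`ρ₃ + σ ≤ ρ_N`, and the nonlocal summand's letters `[N′, M_{h′}] ≤ c_Ne^{−ρ_Nd}` (fine grid), `𝔇([N′,M_{h′}],[N,M_h]) ≤ r_Ne^{−ρ_Nd}` (FILE 56):
`𝔇([Σ∇′*∇′ + W′ + N′ − 𝒱′, M_{h′}]∘X′, [Σ∇*∇ + W + N − 𝒱, M_h]∘X) ≤ 1_S(y′)·r₀·e^{−ρ₃d}` with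
`r₀ = (|J|(c₂m + o₂β′ + 2(c₁m + o₁β′)) + r_W) + (c_Nmc_r + r_Nβ′c_r) + (L·m + L_D·β′ + R(c₁m + o₁β′) + o·c₁β′)c_r`, `β′ = β(1 − βRc_r²)⁻¹`, `m` = files 24∕25's pair-defect constant,
`L = (ℓ(eε)⁻¹ + 2(ω + ℓd₁))R`, `L_D = (ℓ(eε)⁻¹ + 2(ω + ℓd₁))·o + 2R(oo + c₁∕n′ + c₁∕n)`.
[cite: Balaban1984PropagatorsII, (2.91)–(2.92) p.239, (2.133)–(2.134) p.247 (shapes); Balaban1984PropagatorsI, (1.120)–(1.128) pp.37–38; Balaban1985BackgroundPropagators, (3.62)–(3.65) pp.402–403, (3.76)–(3.77) pp.405–406, Thm 3.14 pp.426–427 (difference template)] -/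
theorem hasMaj_idef_commOp_cubeOp_dressedV_in (htri : Triangle254 g) (hd : ∀ a b : g.Site, 0 ≤ g.dist a b) (hsymm : ∀ y y', g.dist y y' = g.dist y' y) (hrow : RowSum g σ cr)
    (hσ : 0 ≤ σ) (hcr : 0 ≤ cr) {ρ₁ ρ₂ ρ₃ ρN δ δV ε β R o mG c₁ c₂ o₁ o₂ rW cN rN ℓ ω d₁ oo : ℝ} (hβ : 0 ≤ β) (hR : 0 ≤ R) (ho : 0 ≤ o) (hmG : 0 ≤ mG) (hσρ : σ ≤ ρ₁)
    (hρ₁V : ρ₁ ≤ δV) (hρ₁G : ρ₁ + σ ≤ δ) (hρ₂ : 0 ≤ ρ₂) (hρ₂₁ : ρ₂ + σ ≤ ρ₁) (hρ₃ : 0 ≤ ρ₃) (hρ₃₂ : ρ₃ ≤ ρ₂) (hρ₃V : ρ₃ + σ ≤ δV - ε) (hρ₃N : ρ₃ + σ ≤ ρN) (hε : 0 < ε)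
    (hc₁ : 0 ≤ c₁) (hc₂ : 0 ≤ c₂) (ho₁ : 0 ≤ o₁) (ho₂ : 0 ≤ o₂) (hrW : 0 ≤ rW) (hcN : 0 ≤ cN) (hrN : 0 ≤ rN) (hℓ : 0 ≤ ℓ) (hω : 0 ≤ ω) (hd₁ : 0 ≤ d₁) (hoo : 0 ≤ oo)
    (hn : 0 < n) (hn' : 0 < n')
    (hDqf : ∀ μ, Dq (Sum.inl μ) = fgrad n (liftEquiv (τ μ) ι)) (hDqb : ∀ μ, Dq (Sum.inr μ) = bgrad n (liftEquiv (τ μ) ι))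
    (hDqf' : ∀ μ, Dq' (Sum.inl μ) = fgrad n' (liftEquiv (τ' μ) ι)) (hDqb' : ∀ μ, Dq' (Sum.inr μ) = bgrad n' (liftEquiv (τ' μ) ι))
    (hDq : ∀ j, D j = Dq j ∘ₗ G₀) (hDq' : ∀ j, D' j = Dq' j ∘ₗ G₀')
    {S : Set g.Site} {χX ψX : X → ℝ} {χX' ψX' : X' → ℝ} (hSχ : ∀ x, χX x ≠ 0 → blk x ∈ S) (hSψ : ∀ x, ψX x ≠ 0 → blk x ∈ S) (hSχ' : ∀ x', χX' x' ≠ 0 → blk (π x') ∈ S)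
    (hSψ' : ∀ x', ψX' x' ≠ 0 → blk (π x') ∈ S) (hGχ : mulOp (fun p : X × ι => χX p.1) ∘ₗ G₀ = G₀) (hDχ : ∀ j, mulOp (fun p : X × ι => χX p.1) ∘ₗ D j = D j)
    (hGψ : G₀ ∘ₗ mulOp (fun p : X × ι => ψX p.1) = G₀) (hGχ' : mulOp (fun p : X' × ι => χX' p.1) ∘ₗ G₀' = G₀') (hDχ' : ∀ j, mulOp (fun p : X' × ι => χX' p.1) ∘ₗ D' j = D' j)
    (hGψ' : G₀' ∘ₗ mulOp (fun p : X' × ι => ψX' p.1) = G₀') {W N : (X × ι → ℝ) →ₗ[ℝ] (X × ι → ℝ)} {W' N' : (X' × ι → ℝ) →ₗ[ℝ] (X' × ι → ℝ)} {h : X × ι → ℝ}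
    {h' : X' × ι → ℝ} {hb : g.Site → ℝ}
    (hh1 : ∀ μ p, |fgrad n (liftEquiv (τ μ) ι) h p| ≤ c₁) (hh1b : ∀ μ p, |bgrad n (liftEquiv (τ μ) ι) h p| ≤ c₁)
    (hh1' : ∀ μ p', |fgrad n' (liftEquiv (τ' μ) ι) h' p'| ≤ c₁) (hh1b' : ∀ μ p', |bgrad n' (liftEquiv (τ' μ) ι) h' p'| ≤ c₁)
    (hh2' : ∀ μ p', |fgradAdj n' (liftEquiv (τ' μ) ι) (fgrad n' (liftEquiv (τ' μ) ι) h') p'| ≤ c₂)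
    (hf1 : ∀ μ p', |fgrad n' (liftEquiv (τ' μ) ι) h' p' - fgrad n (liftEquiv (τ μ) ι) h (liftMap π ι p')| ≤ o₁)
    (hf1b : ∀ μ p', |bgrad n' (liftEquiv (τ' μ) ι) h' p' - bgrad n (liftEquiv (τ μ) ι) h (liftMap π ι p')| ≤ o₁)
    (hf2 : ∀ μ p', |fgradAdj n' (liftEquiv (τ' μ) ι) (fgrad n' (liftEquiv (τ' μ) ι) h') p' - fgradAdj n (liftEquiv (τ μ) ι) (fgrad n (liftEquiv (τ μ) ι) h) (liftMap π ι p')| ≤ o₂)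
    (hLip : ∀ y y', |hb y - hb y'| ≤ ℓ * g.dist y y') (hrh : ∀ p, |h p - hb (liftBlk blk ι p)| ≤ ω) (hrh' : ∀ p', |h' p' - hb (liftBlk (blk ∘ π) ι p')| ≤ ω)
    (hfh : ∀ p', |h' p' - h (liftMap π ι p')| ≤ oo) (hstep : ∀ μ x, g.dist (blk (τ μ x)) (blk x) ≤ d₁) (hstep' : ∀ μ x', g.dist (blk (π (τ' μ x'))) (blk (π x')) ≤ d₁)
    (hG : HasMaj (BlockNorm.ofBlocks g (liftBlk blk ι)) (BlockNorm.ofBlocks g (liftBlk blk ι)) G₀ (fun y y' => β * Real.exp (-(δ * g.dist y y'))))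
    (hD : ∀ j, HasMaj (BlockNorm.ofBlocks g (liftBlk blk ι)) (BlockNorm.ofBlocks g (liftBlk blk ι)) (D j) (fun y y' => β * Real.exp (-(δ * g.dist y y'))))
    (hG' : HasMaj (BlockNorm.ofBlocks g (liftBlk (blk ∘ π) ι)) (BlockNorm.ofBlocks g (liftBlk (blk ∘ π) ι)) G₀' (fun y y' => β * Real.exp (-(δ * g.dist y y'))))
    (hD' : ∀ j, HasMaj (BlockNorm.ofBlocks g (liftBlk (blk ∘ π) ι)) (BlockNorm.ofBlocks g (liftBlk (blk ∘ π) ι)) (D' j) (fun y y' => β * Real.exp (-(δ * g.dist y y'))))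
    (hDG : HasMaj (BlockNorm.ofBlocks g (liftBlk blk ι)) (BlockNorm.ofBlocks g (liftBlk (blk ∘ π) ι)) (idef (pull (liftMap π ι)) (pull (liftMap π ι)) G₀' G₀)
      (fun y y' => mG * Real.exp (-(δ * g.dist y y'))))
    (hDD : ∀ j, HasMaj (BlockNorm.ofBlocks g (liftBlk blk ι)) (BlockNorm.ofBlocks g (liftBlk (blk ∘ π) ι)) (idef (pull (liftMap π ι)) (pull (liftMap π ι)) (D' j) (D j))
      (fun y y' => mG * Real.exp (-(δ * g.dist y y'))))
    (hV : HasMaj (BlockNorm.ofBlocks g (blkPair (liftBlk blk ι))) (BlockNorm.ofBlocks g (liftBlk blk ι)) V (fun y y' => R * Real.exp (-(δV * g.dist y y'))))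
    (hV' : HasMaj (BlockNorm.ofBlocks g (blkPair (liftBlk (blk ∘ π) ι))) (BlockNorm.ofBlocks g (liftBlk (blk ∘ π) ι)) V' (fun y y' => R * Real.exp (-(δV * g.dist y y'))))
    (hDV : HasMaj (BlockNorm.ofBlocks g (blkPair (liftBlk blk ι))) (BlockNorm.ofBlocks g (liftBlk (blk ∘ π) ι))
      (idef (pull (liftPair (liftMap π ι))) (pull (liftMap π ι)) V' V) (fun y y' => o * Real.exp (-(δV * g.dist y y'))))
    (hq : β * (R * cr) * cr < 1)
    (hDW : HasMaj (BlockNorm.ofBlocks g (liftBlk blk ι)) (BlockNorm.ofBlocks g (liftBlk (blk ∘ π) ι))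
      (idef (pull (liftMap π ι)) (pull (liftMap π ι)) (commOp W' h' ∘ₗ (projO none ∘ₗ bgPropV (stack G₀' D') V')) (commOp W h ∘ₗ (projO none ∘ₗ bgPropV (stack G₀ D) V)))
      (fun y y' => ind S y * ind S y' * (rW * Real.exp (-(ρ₂ * g.dist y y')))))
    (hKN' : HasMaj (BlockNorm.ofBlocks g (liftBlk (blk ∘ π) ι)) (BlockNorm.ofBlocks g (liftBlk (blk ∘ π) ι)) (commOp N' h') (fun y y' => cN * Real.exp (-(ρN * g.dist y y'))))
    (hDKN : HasMaj (BlockNorm.ofBlocks g (liftBlk blk ι)) (BlockNorm.ofBlocks g (liftBlk (blk ∘ π) ι))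
      (idef (pull (liftMap π ι)) (pull (liftMap π ι)) (commOp N' h') (commOp N h)) (fun y y' => rN * Real.exp (-(ρN * g.dist y y')))) :
    HasMaj (BlockNorm.ofBlocks g (liftBlk blk ι)) (BlockNorm.ofBlocks g (liftBlk (blk ∘ π) ι))
      (idef (pull (liftMap π ι)) (pull (liftMap π ι))
        (commOp (lapOp n' (fun μ => liftEquiv (τ' μ) ι) W' + N' - V' ∘ₗ stack LinearMap.id Dq') h' ∘ₗ (projO none ∘ₗ bgPropV (stack G₀' D') V'))
        (commOp (lapOp n (fun μ => liftEquiv (τ μ) ι) W + N - V ∘ₗ stack LinearMap.id Dq) h ∘ₗ (projO none ∘ₗ bgPropV (stack G₀ D) V)))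
      (fun y y' => ind S y' *
        (((Fintype.card J * (c₂ * ((mG * cr + 1 * (mG * cr) * (R * (β * (1 - β * (R * cr) * cr)⁻¹) * cr) + β * o * cr * (β * (1 - β * (R * cr) * cr)⁻¹) * cr) * (1 - 1 * (β * (R * cr) * cr))⁻¹)
              + o₂ * (β * (1 - β * (R * cr) * cr)⁻¹)
              + 2 * (c₁ * ((mG * cr + 1 * (mG * cr) * (R * (β * (1 - β * (R * cr) * cr)⁻¹) * cr) + β * o * cr * (β * (1 - β * (R * cr) * cr)⁻¹) * cr) * (1 - 1 * (β * (R * cr) * cr))⁻¹)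
                + o₁ * (β * (1 - β * (R * cr) * cr)⁻¹))) + rW)
          + (cN * ((mG * cr + 1 * (mG * cr) * (R * (β * (1 - β * (R * cr) * cr)⁻¹) * cr) + β * o * cr * (β * (1 - β * (R * cr) * cr)⁻¹) * cr) * (1 - 1 * (β * (R * cr) * cr))⁻¹) * cr
              + rN * (β * (1 - β * (R * cr) * cr)⁻¹) * cr)
          + ((((ℓ * (Real.exp 1 * ε)⁻¹ + 2 * (ω + ℓ * d₁)) * R)
                * ((mG * cr + 1 * (mG * cr) * (R * (β * (1 - β * (R * cr) * cr)⁻¹) * cr) + β * o * cr * (β * (1 - β * (R * cr) * cr)⁻¹) * cr) * (1 - 1 * (β * (R * cr) * cr))⁻¹)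
              + ((ℓ * (Real.exp 1 * ε)⁻¹ + 2 * (ω + ℓ * d₁)) * o + 2 * R * (oo + c₁ / n' + c₁ / n))
                * (β * (1 - β * (R * cr) * cr)⁻¹)
              + R * (c₁ * ((mG * cr + 1 * (mG * cr) * (R * (β * (1 - β * (R * cr) * cr)⁻¹) * cr) + β * o * cr * (β * (1 - β * (R * cr) * cr)⁻¹) * cr) * (1 - 1 * (β * (R * cr) * cr))⁻¹)
                + o₁ * (β * (1 - β * (R * cr) * cr)⁻¹))
              + o * c₁ * (β * (1 - β * (R * cr) * cr)⁻¹)) * cr))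
          * Real.exp (-(ρ₃ * g.dist y y')))) := by
  obtain ⟨hunit, hX⟩ := hasMaj_dressedV_pair blk htri hd hrow hσ hβ hR hcr hσρ hρ₁V hρ₁G hρ₂ hρ₂₁ hG hD hV hq
  obtain ⟨hunit', -⟩ := hasMaj_dressedV_pair (blk ∘ π) htri hd hrow hσ hβ hR hcr hσρ hρ₁V hρ₁G hρ₂ hρ₂₁ hG' hD' hV' hq
  have hq1 : 0 < 1 - β * (R * cr) * cr := by linarith
  have hB : 0 ≤ (β * (1 - β * (R * cr) * cr)⁻¹) := mul_nonneg hβ (inv_nonneg.2 hq1.le)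
  have hI1 : 0 ≤ (1 - β * (R * cr) * cr)⁻¹ := inv_nonneg.2 hq1.le
  have hI2 : 0 ≤ (1 - 1 * (β * (R * cr) * cr))⁻¹ := inv_nonneg.2 (by linarith)
  have hm : 0 ≤ ((mG * cr + 1 * (mG * cr) * (R * (β * (1 - β * (R * cr) * cr)⁻¹) * cr) + β * o * cr * (β * (1 - β * (R * cr) * cr)⁻¹) * cr) * (1 - 1 * (β * (R * cr) * cr))⁻¹) :=
    mul_nonneg (add_nonneg (add_nonneg (mul_nonneg hmG hcr) (mul_nonneg (mul_nonneg zero_le_one (mul_nonneg hmG hcr)) (mul_nonneg (mul_nonneg hR hB) hcr)))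
      (mul_nonneg (mul_nonneg (mul_nonneg (mul_nonneg hβ ho) hcr) hB) hcr)) hI2
  -- (1) the flat half's defect (§2), two-sided at rate `ρ₂`
  have P1 := hasMaj_idef_commOp_lapOp_dressedV_loc₂ blk π τ τ' n n' htri hd hrow hσ hcr hβ hR ho hmG hσρ hρ₁V hρ₁G hρ₂ hρ₂₁ hc₁ hc₂ ho₁ ho₂ hDqf hDqb hDqf' hDqb' hDq hDq'
    hSχ hSψ hSχ' hSψ' hGχ hDχ hGψ hGχ' hDχ' hGψ' hh1' hh1b' hh2' hf1 hf1b hf2 hG hD hG' hD' hDG hDD hV hV' hDV hq hDW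
  -- (2) the nonlocal summand's defect (§3), input-localized at rate `ρ₃`
  have hG0 := hasMaj_dressedV_loc₂ blk htri hd hrow hσ hβ hR hcr hσρ hρ₁V hρ₁G hρ₂ hρ₂₁ hSχ hSψ hGχ hGψ hDq hG hD hV hq
  have hψ0 : mulOp (fun p : X × ι => χX p.1) ∘ₗ (projO none ∘ₗ stack G₀ D) = projO none ∘ₗ stack G₀ D := by
    rw [projO_none_comp_stack]; exact hGχ
  have hψ0' : mulOp (fun p : X' × ι => χX' p.1) ∘ₗ (projO none ∘ₗ stack G₀' D') = projO none ∘ₗ stack G₀' D' := by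
    rw [projO_none_comp_stack]; exact hGχ'
  have hDG0 := hasMaj_idef_projO_dressedV_loc₂ blk π htri hd hrow hσ hcr hβ hR ho hmG hσρ hρ₁V hρ₁G hρ₂ hρ₂₁ hDq hDq' none hSχ hSψ hSχ' hSψ' hψ0 hGψ hψ0' hGψ' hG hD hG' hD'
    hDG hDD hV hV' hDV hq
  have P2 := hasMaj_idef_commOp_comp_in (liftBlk blk ι) (liftMap π ι) htri hd hrow hcN hrN hB hm hρ₃ hρ₃₂ hρ₃N hKN' hDKN hG0 hDG0
  -- (3) the dressed perturbation's defect (file 28), its letters discharged for the concrete jets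
  have hDqE : Dq = fun j : J ⊕ J => Sum.elim (fun μ => fgrad n (liftEquiv (τ μ) ι)) (fun μ => bgrad n (liftEquiv (τ μ) ι)) j := by
    funext j
    rcases j with μ | μ
    · exact hDqf μ
    · exact hDqb μ
  have hDqE' : Dq' = fun j : J ⊕ J => Sum.elim (fun μ => fgrad n' (liftEquiv (τ' μ) ι)) (fun μ => bgrad n' (liftEquiv (τ' μ) ι)) j := by
    funext j
    rcases j with μ | μ
    · exact hDqf' μ
    · exact hDqb' μ
  subst hDqE hDqE'
  have hjet := jet_comp_mulOp (ι := ι) τ n h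
  have hjet' := jet_comp_mulOp (ι := ι) τ' n' h'
  have hω' : 0 ≤ ω + ℓ * d₁ := add_nonneg hω (mul_nonneg hℓ hd₁)
  have hoo' : 0 ≤ oo + c₁ / n' + c₁ / n := add_nonneg (add_nonneg hoo (div_nonneg hc₁ hn'.le)) (div_nonneg hc₁ hn.le)
  have hra := abs_jetReading_sub_le blk τ hsymm hℓ hd₁ hLip hrh hstep
  have hra' := abs_jetReading_sub_le (blk ∘ π) τ' hsymm hℓ hd₁ hLip hrh' hstep'
  have hrh'ω : ∀ p', |h' p' - hb (liftBlk (blk ∘ π) ι p')| ≤ ω + ℓ * d₁ := fun p' => (hrh' p').trans (le_add_of_nonneg_right (mul_nonneg hℓ hd₁))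
  have hfhoo : ∀ p', |h' p' - h (liftMap π ι p')| ≤ oo + c₁ / n' + c₁ / n := fun p' =>
    (hfh p').trans (by linarith [div_nonneg hc₁ hn'.le, div_nonneg hc₁ hn.le])
  have hfa := abs_jetReading_fit_le π τ τ' n n' hn hn' hc₁ hh1 hh1b hh1' hh1b' hfh
  have hC' := hasMaj_comm_nonlocal (blkPair (liftBlk (blk ∘ π) ι)) (liftBlk (blk ∘ π) ι) hR hℓ hω' hε hd hsymm hLip hra' hrh'ω hV'
  have hDC := hasMaj_idef_twistedComm blk π hR ho hℓ hω' hoo' hε hd hsymm hLip hra hrh'ω hfa hfhoo hV hV' hDV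
  have hDX := hasMaj_idef_dressedV_pair blk π htri hd hrow hσ hcr hβ hR ho hmG hσρ hρ₁V hρ₁G hρ₂ hρ₂₁ hG hD hG' hD' hDG hDD hV hV' hDV hq
  have hDh := hasMaj_jetRem_diagK blk τ n hc₁ hh1 hh1b
  have hDh' := hasMaj_jetRem_diagK (blk ∘ π) τ' n' hc₁ hh1' hh1b'
  have hDDh := hasMaj_idef_jetRem_diagK blk π τ τ' n n' ho₁ hf1 hf1b
  have hL : 0 ≤ ((ℓ * (Real.exp 1 * ε)⁻¹ + 2 * (ω + ℓ * d₁)) * R) :=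
    mul_nonneg (add_nonneg (mul_nonneg hℓ (inv_nonneg.2 (mul_nonneg (Real.exp_pos 1).le hε.le))) (mul_nonneg zero_le_two hω')) hR
  have hLD : 0 ≤ ((ℓ * (Real.exp 1 * ε)⁻¹ + 2 * (ω + ℓ * d₁)) * o + 2 * R * (oo + c₁ / n' + c₁ / n)) :=
    add_nonneg (mul_nonneg (add_nonneg (mul_nonneg hℓ (inv_nonneg.2 (mul_nonneg (Real.exp_pos 1).le hε.le))) (mul_nonneg zero_le_two hω')) ho)
      (mul_nonneg (mul_nonneg zero_le_two hR) hoo')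
  have P3 := hasMaj_idef_commOp_dressedPert_comp blk π htri hd hrow hR ho hL hLD hB hm hc₁ ho₁ hε.le hρ₃ hρ₃₂ hρ₃V hjet hjet' hDq hDq' hunit hunit' hC' hDC hX hDX hV' hDV
    hDh hDh' hDDh
  -- input localization of the whole defect row: `X = XM_ψ`, `X′ = X′M_{ψ′}`
  have hinp : (projO none ∘ₗ bgPropV (stack G₀ D) V) ∘ₗ mulOp (fun p : X × ι => ψX p.1) = (projO none ∘ₗ bgPropV (stack G₀ D) V) := by
    rw [LinearMap.comp_assoc, dressedV_comp_eq_self (V := V) hDq hGψ]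
  have hinp' : (projO none ∘ₗ bgPropV (stack G₀' D') V') ∘ₗ mulOp (fun p : X' × ι => ψX' p.1) = (projO none ∘ₗ bgPropV (stack G₀' D') V') := by
    rw [LinearMap.comp_assoc, dressedV_comp_eq_self (V := V') hDq' hGψ']
  have hCflat : 0 ≤ (Fintype.card J * (c₂ * ((mG * cr + 1 * (mG * cr) * (R * (β * (1 - β * (R * cr) * cr)⁻¹) * cr) + β * o * cr * (β * (1 - β * (R * cr) * cr)⁻¹) * cr) * (1 - 1 * (β * (R * cr) * cr))⁻¹) +
        o₂ * (β * (1 - β * (R * cr) * cr)⁻¹) + 2 * (c₁ * ((mG * cr + 1 * (mG * cr) * (R * (β * (1 - β * (R * cr) * cr)⁻¹) * cr) + β * o * cr * (β * (1 - β * (R * cr) * cr)⁻¹) * cr) * (1 - 1 * (β * (R * cr) * cr))⁻¹) +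
        o₁ * (β * (1 - β * (R * cr) * cr)⁻¹))) + rW) :=
    add_nonneg (mul_nonneg (Nat.cast_nonneg _) (add_nonneg (add_nonneg (mul_nonneg hc₂ hm) (mul_nonneg ho₂ hB)) (mul_nonneg zero_le_two (add_nonneg (mul_nonneg hc₁ hm) (mul_nonneg ho₁ hB))))) hrW
  have hCNn : 0 ≤ (cN * ((mG * cr + 1 * (mG * cr) * (R * (β * (1 - β * (R * cr) * cr)⁻¹) * cr) + β * o * cr * (β * (1 - β * (R * cr) * cr)⁻¹) * cr) * (1 - 1 * (β * (R * cr) * cr))⁻¹) * cr + rN * (β * (1 - β * (R * cr) * cr)⁻¹) * cr) :=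
    add_nonneg (mul_nonneg (mul_nonneg hcN hm) hcr) (mul_nonneg (mul_nonneg hrN hB) hcr)
  have hCV : 0 ≤ ((((ℓ * (Real.exp 1 * ε)⁻¹ + 2 * (ω + ℓ * d₁)) * R) * ((mG * cr + 1 * (mG * cr) * (R * (β * (1 - β * (R * cr) * cr)⁻¹) * cr) + β * o * cr * (β * (1 - β * (R * cr) * cr)⁻¹) * cr) * (1 - 1 * (β * (R * cr) * cr))⁻¹) +
        ((ℓ * (Real.exp 1 * ε)⁻¹ + 2 * (ω + ℓ * d₁)) * o + 2 * R * (oo + c₁ / n' + c₁ / n)) * (β * (1 - β * (R * cr) * cr)⁻¹) + R * (c₁ * ((mG * cr + 1 * (mG * cr) * (R * (β * (1 - β * (R * cr) * cr)⁻¹) * cr) +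
        β * o * cr * (β * (1 - β * (R * cr) * cr)⁻¹) * cr) * (1 - 1 * (β * (R * cr) * cr))⁻¹) + o₁ * (β * (1 - β * (R * cr) * cr)⁻¹)) + o * c₁ * (β * (1 - β * (R * cr) * cr)⁻¹)) * cr) :=
    mul_nonneg (add_nonneg (add_nonneg (add_nonneg (mul_nonneg hL hm) (mul_nonneg hLD hB)) (mul_nonneg hR (add_nonneg (mul_nonneg hc₁ hm) (mul_nonneg ho₁ hB)))) (mul_nonneg (mul_nonneg ho hc₁) hB)) hcr
  have hCtot : 0 ≤ ((Fintype.card J * (c₂ * ((mG * cr + 1 * (mG * cr) * (R * (β * (1 - β * (R * cr) * cr)⁻¹) * cr) + β * o * cr * (β * (1 - β * (R * cr) * cr)⁻¹) * cr) * (1 - 1 * (β * (R * cr) * cr))⁻¹) +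
        o₂ * (β * (1 - β * (R * cr) * cr)⁻¹) + 2 * (c₁ * ((mG * cr + 1 * (mG * cr) * (R * (β * (1 - β * (R * cr) * cr)⁻¹) * cr) + β * o * cr * (β * (1 - β * (R * cr) * cr)⁻¹) * cr) * (1 - 1 * (β * (R * cr) * cr))⁻¹) +
        o₁ * (β * (1 - β * (R * cr) * cr)⁻¹))) + rW) + (cN * ((mG * cr + 1 * (mG * cr) * (R * (β * (1 - β * (R * cr) * cr)⁻¹) * cr) + β * o * cr * (β * (1 - β * (R * cr) * cr)⁻¹) * cr) * (1 - 1 * (β * (R * cr) * cr))⁻¹) * cr +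
        rN * (β * (1 - β * (R * cr) * cr)⁻¹) * cr) + ((((ℓ * (Real.exp 1 * ε)⁻¹ + 2 * (ω + ℓ * d₁)) * R) * ((mG * cr + 1 * (mG * cr) * (R * (β * (1 - β * (R * cr) * cr)⁻¹) * cr) +
        β * o * cr * (β * (1 - β * (R * cr) * cr)⁻¹) * cr) * (1 - 1 * (β * (R * cr) * cr))⁻¹) + ((ℓ * (Real.exp 1 * ε)⁻¹ + 2 * (ω + ℓ * d₁)) * o + 2 * R * (oo + c₁ / n' + c₁ / n)) * (β * (1 - β * (R * cr) * cr)⁻¹) + R * (c₁ * ((mG * cr +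
        1 * (mG * cr) * (R * (β * (1 - β * (R * cr) * cr)⁻¹) * cr) + β * o * cr * (β * (1 - β * (R * cr) * cr)⁻¹) * cr) * (1 - 1 * (β * (R * cr) * cr))⁻¹) + o₁ * (β * (1 - β * (R * cr) * cr)⁻¹)) +
        o * c₁ * (β * (1 - β * (R * cr) * cr)⁻¹)) * cr)) := add_nonneg (add_nonneg hCflat hCNn) hCV
  -- the three pieces on one kernel
  have halg : idef (pull (liftMap π ι)) (pull (liftMap π ι)) (commOp (lapOp n' (fun μ => liftEquiv (τ' μ) ι) W' +
        N' - V' ∘ₗ stack LinearMap.id (fun j : J ⊕ J => Sum.elim (fun μ => fgrad n' (liftEquiv (τ' μ) ι)) (fun μ => bgrad n' (liftEquiv (τ' μ) ι)) j)) h' ∘ₗ (projO none ∘ₗ bgPropV (stack G₀' D') V')) (commOp (lapOp n (fun μ => liftEquiv (τ μ) ι) W +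
        N - V ∘ₗ stack LinearMap.id (fun j : J ⊕ J => Sum.elim (fun μ => fgrad n (liftEquiv (τ μ) ι)) (fun μ => bgrad n (liftEquiv (τ μ) ι)) j)) h ∘ₗ (projO none ∘ₗ bgPropV (stack G₀ D) V)) =
        idef (pull (liftMap π ι)) (pull (liftMap π ι)) (commOp (lapOp n' (fun μ => liftEquiv (τ' μ) ι) W') h' ∘ₗ (projO none ∘ₗ bgPropV (stack G₀' D') V')) (commOp (lapOp n (fun μ => liftEquiv (τ μ) ι) W) h ∘ₗ (projO none ∘ₗ bgPropV (stack G₀ D) V)) +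
          idef (pull (liftMap π ι)) (pull (liftMap π ι)) (commOp N' h' ∘ₗ (projO none ∘ₗ bgPropV (stack G₀' D') V')) (commOp N h ∘ₗ (projO none ∘ₗ bgPropV (stack G₀ D) V)) -
          idef (pull (liftMap π ι)) (pull (liftMap π ι)) (commOp (V' ∘ₗ stack LinearMap.id (fun j : J ⊕ J => Sum.elim (fun μ => fgrad n' (liftEquiv (τ' μ) ι)) (fun μ => bgrad n' (liftEquiv (τ' μ) ι)) j)) h' ∘ₗ (projO none ∘ₗ bgPropV (stack G₀' D') V')) (commOp (V ∘ₗ stack LinearMap.id (fun j : J ⊕ J => Sum.elim (fun μ => fgrad n (liftEquiv (τ μ) ι)) (fun μ => bgrad n (liftEquiv (τ μ) ι)) j)) h ∘ₗ (projO none ∘ₗ bgPropV (stack G₀ D) V)) := by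
    simp only [commOp_sub_left, commOp_add_left, LinearMap.sub_comp, LinearMap.add_comp, idef_sub, idef_add]
  have hmain : HasMaj (BlockNorm.ofBlocks g (liftBlk blk ι)) (BlockNorm.ofBlocks g (liftBlk (blk ∘ π) ι)) (idef (pull (liftMap π ι)) (pull (liftMap π ι)) (commOp (lapOp n' (fun μ => liftEquiv (τ' μ) ι) W' +
        N' - V' ∘ₗ stack LinearMap.id (fun j : J ⊕ J => Sum.elim (fun μ => fgrad n' (liftEquiv (τ' μ) ι)) (fun μ => bgrad n' (liftEquiv (τ' μ) ι)) j)) h' ∘ₗ (projO none ∘ₗ bgPropV (stack G₀' D') V')) (commOp (lapOp n (fun μ => liftEquiv (τ μ) ι) W +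
        N - V ∘ₗ stack LinearMap.id (fun j : J ⊕ J => Sum.elim (fun μ => fgrad n (liftEquiv (τ μ) ι)) (fun μ => bgrad n (liftEquiv (τ μ) ι)) j)) h ∘ₗ (projO none ∘ₗ bgPropV (stack G₀ D) V)))
      (fun y y' => ((Fintype.card J * (c₂ * ((mG * cr + 1 * (mG * cr) * (R * (β * (1 - β * (R * cr) * cr)⁻¹) * cr) + β * o * cr * (β * (1 - β * (R * cr) * cr)⁻¹) * cr) * (1 - 1 * (β * (R * cr) * cr))⁻¹) +
            o₂ * (β * (1 - β * (R * cr) * cr)⁻¹) + 2 * (c₁ * ((mG * cr + 1 * (mG * cr) * (R * (β * (1 - β * (R * cr) * cr)⁻¹) * cr) + β * o * cr * (β * (1 - β * (R * cr) * cr)⁻¹) * cr) * (1 - 1 * (β * (R * cr) * cr))⁻¹) +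
            o₁ * (β * (1 - β * (R * cr) * cr)⁻¹))) + rW) + (cN * ((mG * cr + 1 * (mG * cr) * (R * (β * (1 - β * (R * cr) * cr)⁻¹) * cr) + β * o * cr * (β * (1 - β * (R * cr) * cr)⁻¹) * cr) * (1 - 1 * (β * (R * cr) * cr))⁻¹) * cr +
            rN * (β * (1 - β * (R * cr) * cr)⁻¹) * cr) + ((((ℓ * (Real.exp 1 * ε)⁻¹ + 2 * (ω + ℓ * d₁)) * R) * ((mG * cr + 1 * (mG * cr) * (R * (β * (1 - β * (R * cr) * cr)⁻¹) * cr) +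
            β * o * cr * (β * (1 - β * (R * cr) * cr)⁻¹) * cr) * (1 - 1 * (β * (R * cr) * cr))⁻¹) + ((ℓ * (Real.exp 1 * ε)⁻¹ + 2 * (ω + ℓ * d₁)) * o + 2 * R * (oo + c₁ / n' + c₁ / n)) * (β * (1 - β * (R * cr) * cr)⁻¹) +
            R * (c₁ * ((mG * cr + 1 * (mG * cr) * (R * (β * (1 - β * (R * cr) * cr)⁻¹) * cr) + β * o * cr * (β * (1 - β * (R * cr) * cr)⁻¹) * cr) * (1 - 1 * (β * (R * cr) * cr))⁻¹) + o₁ * (β * (1 - β * (R * cr) * cr)⁻¹)) +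
            o * c₁ * (β * (1 - β * (R * cr) * cr)⁻¹)) * cr)) * Real.exp (-(ρ₃ * g.dist y y'))) := by
    rw [halg]
    refine ((P1.add P2).sub P3).mono fun y y' => ?_
    have hexp : Real.exp (-(ρ₂ * g.dist y y')) ≤ Real.exp (-(ρ₃ * g.dist y y')) := Real.exp_le_exp.2 (neg_le_neg (mul_le_mul_of_nonneg_right hρ₃₂ (hd y y')))
    have he3 : 0 ≤ Real.exp (-(ρ₃ * g.dist y y')) := Real.exp_nonneg _
    have hii : 0 ≤ ind S y * ind S y' := mul_nonneg (ind_nonneg _ _) (ind_nonneg _ _)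
    have hi : ind S y * ind S y' ≤ 1 := by
      calc ind S y * ind S y' ≤ 1 * 1 := mul_le_mul (ind_le_one S y) (ind_le_one S y') (ind_nonneg S y') zero_le_one
        _ = 1 := one_mul 1
    have hi' : ind S y' ≤ 1 := ind_le_one S y'
    have k1 : ind S y * ind S y' * ((Fintype.card J * (c₂ * ((mG * cr + 1 * (mG * cr) * (R * (β * (1 - β * (R * cr) * cr)⁻¹) * cr) + β * o * cr * (β * (1 - β * (R * cr) * cr)⁻¹) * cr) * (1 - 1 * (β * (R * cr) * cr))⁻¹) +
          o₂ * (β * (1 - β * (R * cr) * cr)⁻¹) + 2 * (c₁ * ((mG * cr + 1 * (mG * cr) * (R * (β * (1 - β * (R * cr) * cr)⁻¹) * cr) + β * o * cr * (β * (1 - β * (R * cr) * cr)⁻¹) * cr) * (1 - 1 * (β * (R * cr) * cr))⁻¹) +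
          o₁ * (β * (1 - β * (R * cr) * cr)⁻¹))) + rW) * Real.exp (-(ρ₂ * g.dist y y'))) ≤ (Fintype.card J * (c₂ * ((mG * cr + 1 * (mG * cr) * (R * (β * (1 - β * (R * cr) * cr)⁻¹) * cr) +
          β * o * cr * (β * (1 - β * (R * cr) * cr)⁻¹) * cr) * (1 - 1 * (β * (R * cr) * cr))⁻¹) + o₂ * (β * (1 - β * (R * cr) * cr)⁻¹) + 2 * (c₁ * ((mG * cr + 1 * (mG * cr) * (R * (β * (1 - β * (R * cr) * cr)⁻¹) * cr) +
          β * o * cr * (β * (1 - β * (R * cr) * cr)⁻¹) * cr) * (1 - 1 * (β * (R * cr) * cr))⁻¹) + o₁ * (β * (1 - β * (R * cr) * cr)⁻¹))) + rW) * Real.exp (-(ρ₃ * g.dist y y')) := by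
      calc ind S y * ind S y' * ((Fintype.card J * (c₂ * ((mG * cr + 1 * (mG * cr) * (R * (β * (1 - β * (R * cr) * cr)⁻¹) * cr) + β * o * cr * (β * (1 - β * (R * cr) * cr)⁻¹) * cr) * (1 - 1 * (β * (R * cr) * cr))⁻¹) +
            o₂ * (β * (1 - β * (R * cr) * cr)⁻¹) + 2 * (c₁ * ((mG * cr + 1 * (mG * cr) * (R * (β * (1 - β * (R * cr) * cr)⁻¹) * cr) + β * o * cr * (β * (1 - β * (R * cr) * cr)⁻¹) * cr) * (1 - 1 * (β * (R * cr) * cr))⁻¹) +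
            o₁ * (β * (1 - β * (R * cr) * cr)⁻¹))) + rW) * Real.exp (-(ρ₂ * g.dist y y'))) ≤ ind S y * ind S y' * ((Fintype.card J * (c₂ * ((mG * cr + 1 * (mG * cr) * (R * (β * (1 - β * (R * cr) * cr)⁻¹) * cr) +
            β * o * cr * (β * (1 - β * (R * cr) * cr)⁻¹) * cr) * (1 - 1 * (β * (R * cr) * cr))⁻¹) + o₂ * (β * (1 - β * (R * cr) * cr)⁻¹) + 2 * (c₁ * ((mG * cr + 1 * (mG * cr) * (R * (β * (1 - β * (R * cr) * cr)⁻¹) * cr) +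
            β * o * cr * (β * (1 - β * (R * cr) * cr)⁻¹) * cr) * (1 - 1 * (β * (R * cr) * cr))⁻¹) + o₁ * (β * (1 - β * (R * cr) * cr)⁻¹))) + rW) * Real.exp (-(ρ₃ * g.dist y y'))) :=
            mul_le_mul_of_nonneg_left (mul_le_mul_of_nonneg_left hexp hCflat) hii
        _ ≤ 1 * ((Fintype.card J * (c₂ * ((mG * cr + 1 * (mG * cr) * (R * (β * (1 - β * (R * cr) * cr)⁻¹) * cr) + β * o * cr * (β * (1 - β * (R * cr) * cr)⁻¹) * cr) * (1 - 1 * (β * (R * cr) * cr))⁻¹) +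
              o₂ * (β * (1 - β * (R * cr) * cr)⁻¹) + 2 * (c₁ * ((mG * cr + 1 * (mG * cr) * (R * (β * (1 - β * (R * cr) * cr)⁻¹) * cr) + β * o * cr * (β * (1 - β * (R * cr) * cr)⁻¹) * cr) * (1 - 1 * (β * (R * cr) * cr))⁻¹) +
              o₁ * (β * (1 - β * (R * cr) * cr)⁻¹))) + rW) * Real.exp (-(ρ₃ * g.dist y y'))) := mul_le_mul_of_nonneg_right hi (mul_nonneg hCflat he3)
        _ = _ := one_mul _
    have k2 : ind S y' * ((cN * ((mG * cr + 1 * (mG * cr) * (R * (β * (1 - β * (R * cr) * cr)⁻¹) * cr) + β * o * cr * (β * (1 - β * (R * cr) * cr)⁻¹) * cr) * (1 - 1 * (β * (R * cr) * cr))⁻¹) * cr +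
          rN * (β * (1 - β * (R * cr) * cr)⁻¹) * cr) * Real.exp (-(ρ₃ * g.dist y y'))) ≤ (cN * ((mG * cr + 1 * (mG * cr) * (R * (β * (1 - β * (R * cr) * cr)⁻¹) * cr) +
          β * o * cr * (β * (1 - β * (R * cr) * cr)⁻¹) * cr) * (1 - 1 * (β * (R * cr) * cr))⁻¹) * cr + rN * (β * (1 - β * (R * cr) * cr)⁻¹) * cr) * Real.exp (-(ρ₃ * g.dist y y')) := by
      calc ind S y' * ((cN * ((mG * cr + 1 * (mG * cr) * (R * (β * (1 - β * (R * cr) * cr)⁻¹) * cr) + β * o * cr * (β * (1 - β * (R * cr) * cr)⁻¹) * cr) * (1 - 1 * (β * (R * cr) * cr))⁻¹) * cr +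
            rN * (β * (1 - β * (R * cr) * cr)⁻¹) * cr) * Real.exp (-(ρ₃ * g.dist y y'))) ≤ 1 * ((cN * ((mG * cr + 1 * (mG * cr) * (R * (β * (1 - β * (R * cr) * cr)⁻¹) * cr) +
            β * o * cr * (β * (1 - β * (R * cr) * cr)⁻¹) * cr) * (1 - 1 * (β * (R * cr) * cr))⁻¹) * cr + rN * (β * (1 - β * (R * cr) * cr)⁻¹) * cr) * Real.exp (-(ρ₃ * g.dist y y'))) := mul_le_mul_of_nonneg_right hi' (mul_nonneg hCNn he3)
        _ = _ := one_mul _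
    calc ind S y * ind S y' * ((Fintype.card J * (c₂ * ((mG * cr + 1 * (mG * cr) * (R * (β * (1 - β * (R * cr) * cr)⁻¹) * cr) + β * o * cr * (β * (1 - β * (R * cr) * cr)⁻¹) * cr) * (1 - 1 * (β * (R * cr) * cr))⁻¹) +
          o₂ * (β * (1 - β * (R * cr) * cr)⁻¹) + 2 * (c₁ * ((mG * cr + 1 * (mG * cr) * (R * (β * (1 - β * (R * cr) * cr)⁻¹) * cr) + β * o * cr * (β * (1 - β * (R * cr) * cr)⁻¹) * cr) * (1 - 1 * (β * (R * cr) * cr))⁻¹) +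
          o₁ * (β * (1 - β * (R * cr) * cr)⁻¹))) + rW) * Real.exp (-(ρ₂ * g.dist y y'))) + ind S y' * ((cN * ((mG * cr + 1 * (mG * cr) * (R * (β * (1 - β * (R * cr) * cr)⁻¹) * cr) +
          β * o * cr * (β * (1 - β * (R * cr) * cr)⁻¹) * cr) * (1 - 1 * (β * (R * cr) * cr))⁻¹) * cr + rN * (β * (1 - β * (R * cr) * cr)⁻¹) * cr) * Real.exp (-(ρ₃ * g.dist y y'))) + ((((ℓ * (Real.exp 1 * ε)⁻¹ + 2 * (ω +
          ℓ * d₁)) * R) * ((mG * cr + 1 * (mG * cr) * (R * (β * (1 - β * (R * cr) * cr)⁻¹) * cr) + β * o * cr * (β * (1 - β * (R * cr) * cr)⁻¹) * cr) * (1 - 1 * (β * (R * cr) * cr))⁻¹) + ((ℓ * (Real.exp 1 * ε)⁻¹ + 2 * (ω + ℓ * d₁)) * o +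
          2 * R * (oo + c₁ / n' + c₁ / n)) * (β * (1 - β * (R * cr) * cr)⁻¹) + R * (c₁ * ((mG * cr + 1 * (mG * cr) * (R * (β * (1 - β * (R * cr) * cr)⁻¹) * cr) +
          β * o * cr * (β * (1 - β * (R * cr) * cr)⁻¹) * cr) * (1 - 1 * (β * (R * cr) * cr))⁻¹) + o₁ * (β * (1 - β * (R * cr) * cr)⁻¹)) + o * c₁ * (β * (1 - β * (R * cr) * cr)⁻¹)) * cr) * Real.exp (-(ρ₃ * g.dist y y'))
        ≤ (Fintype.card J * (c₂ * ((mG * cr + 1 * (mG * cr) * (R * (β * (1 - β * (R * cr) * cr)⁻¹) * cr) + β * o * cr * (β * (1 - β * (R * cr) * cr)⁻¹) * cr) * (1 - 1 * (β * (R * cr) * cr))⁻¹) + o₂ * (β * (1 - β * (R * cr) * cr)⁻¹) +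
              2 * (c₁ * ((mG * cr + 1 * (mG * cr) * (R * (β * (1 - β * (R * cr) * cr)⁻¹) * cr) + β * o * cr * (β * (1 - β * (R * cr) * cr)⁻¹) * cr) * (1 - 1 * (β * (R * cr) * cr))⁻¹) + o₁ * (β * (1 - β * (R * cr) * cr)⁻¹))) +
              rW) * Real.exp (-(ρ₃ * g.dist y y')) + (cN * ((mG * cr + 1 * (mG * cr) * (R * (β * (1 - β * (R * cr) * cr)⁻¹) * cr) + β * o * cr * (β * (1 - β * (R * cr) * cr)⁻¹) * cr) * (1 - 1 * (β * (R * cr) * cr))⁻¹) * cr +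
              rN * (β * (1 - β * (R * cr) * cr)⁻¹) * cr) * Real.exp (-(ρ₃ * g.dist y y')) + ((((ℓ * (Real.exp 1 * ε)⁻¹ + 2 * (ω + ℓ * d₁)) * R) * ((mG * cr + 1 * (mG * cr) * (R * (β * (1 - β * (R * cr) * cr)⁻¹) * cr) +
              β * o * cr * (β * (1 - β * (R * cr) * cr)⁻¹) * cr) * (1 - 1 * (β * (R * cr) * cr))⁻¹) + ((ℓ * (Real.exp 1 * ε)⁻¹ + 2 * (ω + ℓ * d₁)) * o + 2 * R * (oo + c₁ / n' + c₁ / n)) * (β * (1 - β * (R * cr) * cr)⁻¹) +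
              R * (c₁ * ((mG * cr + 1 * (mG * cr) * (R * (β * (1 - β * (R * cr) * cr)⁻¹) * cr) + β * o * cr * (β * (1 - β * (R * cr) * cr)⁻¹) * cr) * (1 - 1 * (β * (R * cr) * cr))⁻¹) + o₁ * (β * (1 - β * (R * cr) * cr)⁻¹)) +
              o * c₁ * (β * (1 - β * (R * cr) * cr)⁻¹)) * cr) * Real.exp (-(ρ₃ * g.dist y y')) :=
          add_le_add (add_le_add k1 k2) le_rfl
      _ = ((Fintype.card J * (c₂ * ((mG * cr + 1 * (mG * cr) * (R * (β * (1 - β * (R * cr) * cr)⁻¹) * cr) + β * o * cr * (β * (1 - β * (R * cr) * cr)⁻¹) * cr) * (1 - 1 * (β * (R * cr) * cr))⁻¹) + o₂ * (β * (1 - β * (R * cr) * cr)⁻¹) +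
            2 * (c₁ * ((mG * cr + 1 * (mG * cr) * (R * (β * (1 - β * (R * cr) * cr)⁻¹) * cr) + β * o * cr * (β * (1 - β * (R * cr) * cr)⁻¹) * cr) * (1 - 1 * (β * (R * cr) * cr))⁻¹) + o₁ * (β * (1 - β * (R * cr) * cr)⁻¹))) + rW) +
            (cN * ((mG * cr + 1 * (mG * cr) * (R * (β * (1 - β * (R * cr) * cr)⁻¹) * cr) + β * o * cr * (β * (1 - β * (R * cr) * cr)⁻¹) * cr) * (1 - 1 * (β * (R * cr) * cr))⁻¹) * cr + rN * (β * (1 - β * (R * cr) * cr)⁻¹) * cr) +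
            ((((ℓ * (Real.exp 1 * ε)⁻¹ + 2 * (ω + ℓ * d₁)) * R) * ((mG * cr + 1 * (mG * cr) * (R * (β * (1 - β * (R * cr) * cr)⁻¹) * cr) + β * o * cr * (β * (1 - β * (R * cr) * cr)⁻¹) * cr) * (1 - 1 * (β * (R * cr) * cr))⁻¹) +
            ((ℓ * (Real.exp 1 * ε)⁻¹ + 2 * (ω + ℓ * d₁)) * o + 2 * R * (oo + c₁ / n' + c₁ / n)) * (β * (1 - β * (R * cr) * cr)⁻¹) + R * (c₁ * ((mG * cr + 1 * (mG * cr) * (R * (β * (1 - β * (R * cr) * cr)⁻¹) * cr) +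
            β * o * cr * (β * (1 - β * (R * cr) * cr)⁻¹) * cr) * (1 - 1 * (β * (R * cr) * cr))⁻¹) + o₁ * (β * (1 - β * (R * cr) * cr)⁻¹)) + o * c₁ * (β * (1 - β * (R * cr) * cr)⁻¹)) * cr)) * Real.exp (-(ρ₃ * g.dist y y')) := by ring
  refine hasMaj_localize_in blk (fun a b => mul_nonneg hCtot (Real.exp_nonneg _)) (fun μ hμ => ?_) hmain
  have hz : (projO none ∘ₗ bgPropV (stack G₀ D) V) μ = 0 := by
    rw [← hinp, LinearMap.comp_apply, mulOp_eq_zero_of_vanish blk hSψ μ hμ, map_zero]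
  have hz' : (projO none ∘ₗ bgPropV (stack G₀' D') V') (pull (liftMap π ι) μ) = 0 := by
    rw [← hinp', LinearMap.comp_apply, mulOp_eq_zero_of_vanish (blk ∘ π) hSψ' (pull (liftMap π ι) μ) (fun p' hp' => by rw [pull_apply]; exact hμ (liftMap π ι p') hp'), map_zero]
  rw [idef_apply, LinearMap.comp_apply, hz', map_zero, LinearMap.comp_apply, hz, map_zero, map_zero, sub_zero]
end Row

end Summit.QuantumFields.YangMills.BalabanUVNodes.N15.CurvedSpecies

end
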